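import Mathlib
import HarnessLib

/-!
# Non-square descent — «FREE OF RANK ONE ⟺ FINITE INDEX» for the cyclic Robert system (the parenthetical of stub S1 and the freeness
# hypothesis `hu` of stub S2 of the line card `nonsquare-descent`) for the seed crux `SignedMuSeedAtTwoPlus` stmt-BirchSwinnertonDyer-21438
# (parent Kμ⁺ `SignedMuVanishingAtTwoPlus` stmt-BirchSwinnertonDyer-20689, route ResidualThetaTransportAtTwo)

Cell `bsd-wall`, width seat `bsd-wall-rtt-p4-w2` g17 (`--supports`, closes nothing).  THEOREMS ONLY; BSD is not proved by this; nothing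
arithmetic is asserted.

Stub S1 `cyclicRobertSystem` of `Cruxes/SignedMuSeedAtTwoPlus/Lines/nonsquare-descent.md` ends with «`𝓒'_m = 𝒪[G_m]u_m` is free of rank `1`
over `𝒪[G_m]` (⟺ `[𝓔_m^χ : 𝓒'_m] < ∞`)», the finite index being what Kronecker's second limit formula supplies; the freeness is consumed by
stub S2 in the form `hu : ∀ r, r • u = 0 → ω_m ∣ r` (`Theorems/…NonsquareDescentFreeness.lean`, `…Assembly.lean`).  This file proves the
equivalence and the dictionary:

* §1 `injective_iff_forall_exists_smul_eq_zero` — **rank–nullity criterion over a domain `𝒪`**: for a linear map `f : M → N` between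
  finite `𝒪`-modules of the SAME `finrank`, with `M` torsion-free, `f` is injective iff its cokernel `N ⧸ range f` is torsion
  (`𝓒'_m ≅ 𝒪[G_m]` free ⟺ finite index, both sides being `𝒪`-lattices of rank `2^m`).
* §2 the annihilator dictionary for `u ∈ E` over a commutative ring `R` (`Λ'`) and `ω ∈ R` (`ω_m`): `ann_le_span_iff`
  (`hu ⟺ ker(r ↦ r•u) ≤ (ω)`), `ker_toSpanSingleton_eq_span` (with `ω • u = 0`: `ann(u) = (ω)`), **`nonempty_quotient_linearEquiv_span`**
  (`R/(ω) ≃ R∙u`: «`𝒪[G_m]u_m ≅ 𝒪[G_m]`»), `span_le_ker_toSpanSingleton`, **`liftQ_toSpanSingleton_injective_iff`** (the induced map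
  `R/(ω) → E` is injective iff `hu`).
* §3 **`dvd_of_smul_eq_zero_of_quotient_torsion`** — §1 + §2 over an `𝒪`-algebra `R` acting on `E` compatibly: if `R/(ω)` and `E` are finite
  over `𝒪` of the same `finrank`, `R/(ω)` is `𝒪`-torsion-free, `ω • u = 0` and `E ⧸ R∙u` is `𝒪`-torsion (finite index), then `hu` holds —
  «finite index ⟹ `𝒪[G_m]u_m` free of rank one».

[folklore]
-/

set_option autoImplicit false
-- the Theorems namespace of this sub repeats the summit name by design (D-0017 nested layout)
set_option linter.dupNamespace false

namespace Summit.BirchSwinnertonDyer.BirchSwinnertonDyer.Theorems.SignedMuAtTwo.NonsquareDescent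

/-! ## §1 Rank–nullity: injective ⟺ torsion cokernel (same rank) -/

section RankNullity

variable {𝒪 : Type*} [CommRing 𝒪] [IsDomain 𝒪] {M N : Type*} [AddCommGroup M] [Module 𝒪 M] [AddCommGroup N]
  [Module 𝒪 N]

/-- **Injective ⟺ torsion cokernel** for a linear map between finite modules of the same `finrank` over a domain, the source being
torsion-free (rank–nullity). [folklore] -/
theorem injective_iff_forall_exists_smul_eq_zero [Module.Finite 𝒪 M] [Module.Finite 𝒪 N] [Module.IsTorsionFree 𝒪 M]
    (f : M →ₗ[𝒪] N) (h : Module.finrank 𝒪 M = Module.finrank 𝒪 N) :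
    Function.Injective f ↔ ∀ y : N ⧸ LinearMap.range f, ∃ a : 𝒪, a ≠ 0 ∧ a • y = 0 := by
  rw [← Module.finrank_eq_zero_iff]
  have hN := Submodule.finrank_quotient_add_finrank (LinearMap.range f)
  have hM := Submodule.finrank_quotient_add_finrank (LinearMap.ker f)
  have hq := LinearEquiv.finrank_eq f.quotKerEquivRange
  constructor
  · intro hf
    have hk : Module.finrank 𝒪 (LinearMap.ker f) = 0 := by
      rw [LinearMap.ker_eq_bot.mpr hf, finrank_bot]
    omega
  · intro h0
    have hk : Module.finrank 𝒪 (LinearMap.ker f) = 0 := by omega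
    refine LinearMap.ker_eq_bot.mp (Submodule.rank_eq_zero.mp ?_)
    rw [← Submodule.finrank_eq_rank, hk, Nat.cast_zero]

end RankNullity

/-! ## §2 The annihilator dictionary -/

section Ann

variable {R : Type*} [CommRing R] {E : Type*} [AddCommGroup E] [Module R E]

/-- `hu ⟺ ann(u) ≤ (ω)`: `(∀ r, r • u = 0 → ω ∣ r) ↔ ker (r ↦ r • u) ≤ Ideal.span {ω}`. [folklore] -/
theorem ann_le_span_iff (u : E) (ω : R) :
    (∀ r : R, r • u = 0 → ω ∣ r) ↔ LinearMap.ker (LinearMap.toSpanSingleton R E u) ≤ Ideal.span {ω} := by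
  refine ⟨fun h r hr => ?_, fun h r hr => ?_⟩
  · rw [LinearMap.mem_ker, LinearMap.toSpanSingleton_apply] at hr
    exact Ideal.mem_span_singleton.mpr (h r hr)
  · have hr' : r ∈ LinearMap.ker (LinearMap.toSpanSingleton R E u) := by
      rw [LinearMap.mem_ker, LinearMap.toSpanSingleton_apply]; exact hr
    exact Ideal.mem_span_singleton.mp (h hr')

/-- `ω • u = 0 ⇒ (ω) ≤ ann(u) = ker (r ↦ r • u)`. [folklore] -/
theorem span_le_ker_toSpanSingleton {u : E} {ω : R} (hu0 : ω • u = 0) :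
    Ideal.span {ω} ≤ LinearMap.ker (LinearMap.toSpanSingleton R E u) := by
  rw [Ideal.span_le, Set.singleton_subset_iff, SetLike.mem_coe, LinearMap.mem_ker,
    LinearMap.toSpanSingleton_apply]
  exact hu0

/-- **`ann(u) = (ω)` exactly** from `ω • u = 0` and `hu`. [folklore] -/
theorem ker_toSpanSingleton_eq_span {u : E} {ω : R} (hu0 : ω • u = 0) (hu : ∀ r : R, r • u = 0 → ω ∣ r) :
    LinearMap.ker (LinearMap.toSpanSingleton R E u) = Ideal.span {ω} :=
  le_antisymm ((ann_le_span_iff u ω).mp hu) (span_le_ker_toSpanSingleton hu0)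

/-- **`R/(ω) ≃ R∙u`** («`𝒪[G_m]·u_m ≅ 𝒪[G_m] = Λ'/ω_m`, free of rank one») from `ω • u = 0` and `hu`. [folklore] -/
theorem nonempty_quotient_linearEquiv_span {u : E} {ω : R} (hu0 : ω • u = 0) (hu : ∀ r : R, r • u = 0 → ω ∣ r) :
    Nonempty ((R ⧸ Ideal.span {ω}) ≃ₗ[R] Submodule.span R {u}) := by
  have hker := ker_toSpanSingleton_eq_span hu0 hu
  exact ⟨(Submodule.quotEquivOfEq _ _ hker.symm).trans
    ((LinearMap.toSpanSingleton R E u).quotKerEquivRange.trans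
      (LinearEquiv.ofEq _ _ (LinearMap.span_singleton_eq_range R E u).symm))⟩

/-- **The induced map `R/(ω) → E`, `r̄ ↦ r • u`, is injective iff `hu`.** [folklore] -/
theorem liftQ_toSpanSingleton_injective_iff {u : E} {ω : R}
    (h : Ideal.span {ω} ≤ LinearMap.ker (LinearMap.toSpanSingleton R E u)) :
    Function.Injective ((Ideal.span {ω}).liftQ (LinearMap.toSpanSingleton R E u) h)
      ↔ ∀ r : R, r • u = 0 → ω ∣ r := by
  constructor
  · intro hinj r hr
    have h1 : (Ideal.span {ω}).liftQ (LinearMap.toSpanSingleton R E u) h (Submodule.Quotient.mk r) = 0 := by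
      rw [Submodule.liftQ_apply, LinearMap.toSpanSingleton_apply, hr]
    rw [← map_zero ((Ideal.span {ω}).liftQ (LinearMap.toSpanSingleton R E u) h)] at h1
    have h2 := hinj h1
    rw [Submodule.Quotient.mk_eq_zero] at h2
    exact Ideal.mem_span_singleton.mp h2
  · intro hu
    rw [← LinearMap.ker_eq_bot]
    exact Submodule.ker_liftQ_eq_bot _ _ _ ((ann_le_span_iff u ω).mp hu)

end Ann

/-! ## §3 Finite index ⟹ free of rank one -/

section FiniteIndex

variable {𝒪 R E : Type*} [CommRing 𝒪] [IsDomain 𝒪] [CommRing R] [Algebra 𝒪 R] [AddCommGroup E] [Module R E]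
  [Module 𝒪 E] [IsScalarTower 𝒪 R E]

/-- **Finite index ⟹ `𝒪[G_m]u_m` is free of rank one** (in the currency `hu` of the freeness descent).  Let `R` be an `𝒪`-algebra
(`Λ'`, `𝒪` a domain) acting on `E` (`𝓔_m^χ`) compatibly, `ω ∈ R` (`ω_m`) with `ω • u = 0`, `R/(ω)` (`= 𝒪[G_m]`) finite and torsion-free over
`𝒪` of the same `𝒪`-rank as `E` (both `2^m`), and suppose the index is finite in the sense that `E ⧸ R∙u` is `𝒪`-torsion.  Then every `r`
with `r • u = 0` is divisible by `ω`. [folklore] -/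
theorem dvd_of_smul_eq_zero_of_quotient_torsion (ω : R) (u : E) (hu0 : ω • u = 0)
    [Module.Finite 𝒪 (R ⧸ Ideal.span {ω})] [Module.IsTorsionFree 𝒪 (R ⧸ Ideal.span {ω})] [Module.Finite 𝒪 E]
    (hrank : Module.finrank 𝒪 (R ⧸ Ideal.span {ω}) = Module.finrank 𝒪 E)
    (htors : ∀ y : E ⧸ Submodule.span R {u}, ∃ a : 𝒪, a ≠ 0 ∧ a • y = 0) :
    ∀ r : R, r • u = 0 → ω ∣ r := by
  have hle := span_le_ker_toSpanSingleton hu0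
  set φ : (R ⧸ Ideal.span {ω}) →ₗ[R] E :=
    (Ideal.span {ω}).liftQ (LinearMap.toSpanSingleton R E u) hle with hφdef
  have hrange : LinearMap.range (φ.restrictScalars 𝒪) = (Submodule.span R {u}).restrictScalars 𝒪 := by
    rw [LinearMap.range_restrictScalars, hφdef, Submodule.range_liftQ, ← LinearMap.span_singleton_eq_range]
  have e : (E ⧸ LinearMap.range (φ.restrictScalars 𝒪)) ≃ₗ[𝒪] E ⧸ Submodule.span R {u} :=
    (Submodule.quotEquivOfEq _ _ hrange).trans (Submodule.Quotient.restrictScalarsEquiv 𝒪 (Submodule.span R {u}))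
  have hφ : Function.Injective (φ.restrictScalars 𝒪) := by
    rw [injective_iff_forall_exists_smul_eq_zero (φ.restrictScalars 𝒪) hrank]
    intro y
    obtain ⟨a, ha, hay⟩ := htors (e y)
    refine ⟨a, ha, e.injective ?_⟩
    rw [map_smul, hay, map_zero]
  have hφ' : Function.Injective φ := fun x y hxy => hφ (by simpa using hxy)
  exact (liftQ_toSpanSingleton_injective_iff hle).mp hφ'

end FiniteIndex

end Summit.BirchSwinnertonDyer.BirchSwinnertonDyer.Theorems.SignedMuAtTwo.NonsquareDescent
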